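import Mathlib.MeasureTheory.Function.LpSpace.Basic
import HarnessLib

/-!
# Transport of `Lᵖ` along an a.e.-invertible measurable map

Library brick (topic `Literature/MeasureTheory/Function`; Mathlib-only imports; one definition with a
body, theorems otherwise; no named fact).

For a measure `μ` on `α`, a measurable `e : α → β` and a measurable `j : β → α` with `j ∘ e = id`
`μ`-a.e., the image measure `μ.map e` (Bogachev–Smolyanov, *Real and Functional Analysis* (2020)
§3.12: the measure `μ ∘ e⁻¹` and the change of variables formula, Thm 3.12.2,
`∫_Y g d(μ∘e⁻¹) = ∫_X g∘e dμ` (3.12.1)) satisfies: `j` pushes `μ.map e` back to `μ`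
(`measurePreserving_of_ae_leftInverse`), so Mathlib's pull-back isometries
`Lp.compMeasurePreservingₗᵢ` along `e` (`Lᵖ(μ.map e) → Lᵖ(μ)`, `h ↦ h ∘ e`) and along `j`
(`Lᵖ(μ) → Lᵖ(μ.map e)`, `g ↦ g ∘ j`) are mutually inverse.  We package them as the linear isometric
EQUIVALENCE `lpPullbackEquiv 𝕜 μ he hj hje : Lp E p μ ≃ₗᵢ[𝕜] Lp E p (μ.map e)` with the a.e. formulas
`coeFn_lpPullbackEquiv` (`T g = g ∘ j` a.e.) and `coeFn_lpPullbackEquiv_symm` (`T⁻¹ h = h ∘ e` a.e.).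

Mathlib has `Lp.compMeasurePreservingₗᵢ` (an isometry INTO) and measurable-EQUIVALENCE transports; the
point here is that only an a.e. one-sided inverse is needed (typical use: `e` injective off a null set,
e.g. transporting the spectral representation of a normal operator from `ℂ` to `ℝ` along a coordinate
that is injective on the spectrum minus a null point — Reed–Simon I, proof of Thm VIII.4).

## References
* V. I. Bogachev, O. G. Smolyanov, *Real and Functional Analysis*, Moscow Lectures 4, Springer 2020,
  §3.12 (image measure), Thm 3.12.2 / (3.12.1) (held copy pdf p0207). [BogachevSmolyanov2020]
-/

noncomputable section

open MeasureTheory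
open _root_.Filter
open scoped ENNReal

namespace Literature.MeasureTheory.Function

variable {α β : Type*} [MeasurableSpace α] [MeasurableSpace β]
  {E : Type*} [NormedAddCommGroup E] {p : ℝ≥0∞} [Fact (1 ≤ p)]
  (𝕜 : Type*) [NormedRing 𝕜] [Module 𝕜 E] [IsBoundedSMul 𝕜 E]
  (μ : Measure α) {e : α → β} {j : β → α}

/-- If `j ∘ e = id` `μ`-a.e. then `j` pushes the image measure `μ.map e` back to `μ`
(`(μ∘e⁻¹)∘j⁻¹ = μ∘(j∘e)⁻¹ = μ`). [cite: BogachevSmolyanov2020, §3.12 Thm 3.12.2 (3.12.1)] -/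
theorem measurePreserving_of_ae_leftInverse (he : Measurable e) (hj : Measurable j)
    (hje : ∀ᵐ x ∂μ, j (e x) = x) : MeasurePreserving j (μ.map e) μ := by
  refine ⟨hj, ?_⟩
  rw [Measure.map_map hj he]
  have : (j ∘ e) =ᵐ[μ] id := hje.mono fun x hx => hx
  rw [Measure.map_congr this, Measure.map_id]

omit [Fact (1 ≤ p)] in
/-- Pull-back along `j` followed by pull-back along `e` is the identity of `Lᵖ(μ)`:
`(g ∘ j) ∘ e = g` a.e. [cite: BogachevSmolyanov2020, §3.12 Thm 3.12.2 (3.12.1)] -/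
theorem compMeasurePreserving_comp_eq_self (he : Measurable e) (hj : Measurable j)
    (hje : ∀ᵐ x ∂μ, j (e x) = x) (g : Lp E p μ) :
    Lp.compMeasurePreserving e (Measurable.measurePreserving he μ)
      (Lp.compMeasurePreserving j (measurePreserving_of_ae_leftInverse μ he hj hje) g) = g := by
  apply Lp.ext
  have h1 := Lp.coeFn_compMeasurePreserving
    (Lp.compMeasurePreserving j (measurePreserving_of_ae_leftInverse μ he hj hje) g)
    (Measurable.measurePreserving he μ)
  have h2 : (Lp.compMeasurePreserving j (measurePreserving_of_ae_leftInverse μ he hj hje) g : β → E) ∘ e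
      =ᵐ[μ] ((g : α → E) ∘ j) ∘ e :=
    ae_eq_comp he.aemeasurable (Lp.coeFn_compMeasurePreserving g _)
  filter_upwards [h1, h2, hje] with x hx1 hx2 hx3
  rw [hx1, hx2, Function.comp_apply, Function.comp_apply, hx3]

/-- The pull-back along `j`, `Lᵖ(μ) → Lᵖ(μ.map e)`, is surjective (its composition with the injective
pull-back along `e` is the identity). [cite: BogachevSmolyanov2020, §3.12 Thm 3.12.2 (3.12.1)] -/
theorem surjective_compMeasurePreserving (he : Measurable e) (hj : Measurable j)
    (hje : ∀ᵐ x ∂μ, j (e x) = x) :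
    Function.Surjective
      (Lp.compMeasurePreservingₗᵢ (E := E) (p := p) 𝕜 j (measurePreserving_of_ae_leftInverse μ he hj hje)) := by
  intro h
  refine ⟨Lp.compMeasurePreserving e (Measurable.measurePreserving he μ) h, ?_⟩
  -- `T` (pull-back along `e`) is injective and `T (S (T h)) = T h`
  have hinj : Function.Injective
      (Lp.compMeasurePreservingₗᵢ (E := E) (p := p) 𝕜 e (Measurable.measurePreserving he μ)) :=
    (Lp.compMeasurePreservingₗᵢ (E := E) (p := p) 𝕜 e (Measurable.measurePreserving he μ)).injective
  apply hinj
  exact compMeasurePreserving_comp_eq_self μ he hj hje _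

/-- **`Lᵖ(μ) ≃ Lᵖ(μ.map e)`** (linear isometric equivalence) for a measurable `e : α → β` with a
measurable `μ`-a.e. left inverse `j`: `g ↦ g ∘ j`, with inverse `h ↦ h ∘ e` (the change of variables
formula for the image measure makes both pull-backs isometric).
[cite: BogachevSmolyanov2020, §3.12 Thm 3.12.2 (3.12.1)] -/
def lpPullbackEquiv (he : Measurable e) (hj : Measurable j) (hje : ∀ᵐ x ∂μ, j (e x) = x) :
    Lp E p μ ≃ₗᵢ[𝕜] Lp E p (μ.map e) :=
  LinearIsometryEquiv.ofSurjective
    (Lp.compMeasurePreservingₗᵢ (E := E) (p := p) 𝕜 j (measurePreserving_of_ae_leftInverse μ he hj hje))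
    (surjective_compMeasurePreserving 𝕜 μ he hj hje)

/-- `T g` is Mathlib's pull-back of `g` along `j`. [cite: BogachevSmolyanov2020, §3.12 Thm 3.12.2 (3.12.1)] -/
theorem lpPullbackEquiv_apply (he : Measurable e) (hj : Measurable j) (hje : ∀ᵐ x ∂μ, j (e x) = x)
    (g : Lp E p μ) :
    lpPullbackEquiv 𝕜 μ he hj hje g =
      Lp.compMeasurePreserving j (measurePreserving_of_ae_leftInverse μ he hj hje) g := rfl

/-- `T g = g ∘ j` almost everywhere for `μ.map e`. [cite: BogachevSmolyanov2020, §3.12 Thm 3.12.2 (3.12.1)] -/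
theorem coeFn_lpPullbackEquiv (he : Measurable e) (hj : Measurable j) (hje : ∀ᵐ x ∂μ, j (e x) = x)
    (g : Lp E p μ) :
    (lpPullbackEquiv 𝕜 μ he hj hje g : β → E) =ᵐ[μ.map e] (g : α → E) ∘ j :=
  Lp.coeFn_compMeasurePreserving g _

/-- `T⁻¹ h` is Mathlib's pull-back of `h` along `e`. [cite: BogachevSmolyanov2020, §3.12 Thm 3.12.2 (3.12.1)] -/
theorem lpPullbackEquiv_symm_apply (he : Measurable e) (hj : Measurable j) (hje : ∀ᵐ x ∂μ, j (e x) = x)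
    (h : Lp E p (μ.map e)) :
    (lpPullbackEquiv 𝕜 μ he hj hje).symm h =
      Lp.compMeasurePreserving e (Measurable.measurePreserving he μ) h := by
  apply (lpPullbackEquiv 𝕜 μ he hj hje).injective
  rw [LinearIsometryEquiv.apply_symm_apply, lpPullbackEquiv_apply]
  have hinj : Function.Injective
      (Lp.compMeasurePreservingₗᵢ (E := E) (p := p) 𝕜 e (Measurable.measurePreserving he μ)) :=
    (Lp.compMeasurePreservingₗᵢ (E := E) (p := p) 𝕜 e (Measurable.measurePreserving he μ)).injective
  apply hinj
  exact (compMeasurePreserving_comp_eq_self μ he hj hje _).symm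

/-- `T⁻¹ h = h ∘ e` almost everywhere for `μ`. [cite: BogachevSmolyanov2020, §3.12 Thm 3.12.2 (3.12.1)] -/
theorem coeFn_lpPullbackEquiv_symm (he : Measurable e) (hj : Measurable j) (hje : ∀ᵐ x ∂μ, j (e x) = x)
    (h : Lp E p (μ.map e)) :
    ((lpPullbackEquiv 𝕜 μ he hj hje).symm h : α → E) =ᵐ[μ] (h : β → E) ∘ e := by
  rw [lpPullbackEquiv_symm_apply]
  exact Lp.coeFn_compMeasurePreserving h _

/-- The a.e.-inverse relation in the other direction, `e ∘ j = id` a.e. for the image measure, follows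
(when the fixed-point set is measurable). [cite: BogachevSmolyanov2020, §3.12 Thm 3.12.2 (3.12.1)] -/
theorem ae_map_rightInverse (he : Measurable e) (hje : ∀ᵐ x ∂μ, j (e x) = x)
    (hS : MeasurableSet {y : β | e (j y) = y}) :
    ∀ᵐ y ∂(μ.map e), e (j y) = y := by
  rw [ae_map_iff he.aemeasurable hS]
  filter_upwards [hje] with x hx
  rw [hx]

end Literature.MeasureTheory.Function
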